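import Literature.AlgebraicGeometry.HodgeTheory.NoTypeIVFactorCentralPullbacks
import HarnessLib

/-!
# `Z(End⁰ A)` inside a TOTALLY REAL subfield `ℚ(φ′) ⊆ End⁰(A)` ⟹ no factor of type IV (so `Hdg` is semisimple and every
# `W_F` is Hodge) — Moonen–Zarhin 1998 §1, Remark (1) after Criterion (2) meeting the second Remark

Layer `Literature/AlgebraicGeometry/HodgeTheory`, theorem-only sequel (no definition, no named fact, no `sorry`) of the
seat's `NoTypeIVFactorCentralPullbacks` (`HasNoTypeIVFactor A` ⟺ central pull-backs have real spectrum on `H¹`) and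
`WeilClassesFieldCentreInSubfield` («`F′ ⊇ E`» read in `End⁰(A)`).

PRINTED CONTEXT.  B. J. J. Moonen – Yu. G. Zarhin, *Weil classes on abelian varieties*, J. reine angew. Math. 496 (1998) =
arXiv:alg-geom/9612017, §1 (chunks p0002, p0004): the second Remark after the Criterion («If all simple factors of `X` are of
type 1, 2 or 3 … then every subfield `F ⊆ End⁰(X)` satisfies … `n_σ = n_σ′`»; types 1–3 = the centre `E` of `End⁰(Y)` is
totally real, type 4 = `E` is a CM field, Lange–Birkenhake §5.5) and Remark (1) after Criterion (2) («if `F′ ⊇ E` …»).  When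
`F′ ⊇ E` is TOTALLY REAL the two meet: `E ⊆ F′` is then totally real, i.e. there is no factor of type IV.  This file
proves that junction on the tree's carriers and predicate.

RENDERING.  `A` a complex abelian variety; «`F′ = ℚ(φ′) ⊇ E`» = `Subalgebra.center ℚ A.endAlgebra ≤ Algebra.adjoin ℚ
{endAlgebra.of A φ′}` (`P′(φ′) = 0`, `P′ ∈ ℤ[T]` irreducible over `ℚ`); «`F′` totally real» = every complex root of `P′` is
real; «no factor of type IV» = `HasNoTypeIVFactor A`.

WHAT IS PROVED.
* §1 **`exists_smul_pullbackOne_eq_aeval_of_center_le_adjoin`** — the seat's dictionary with its `ℚ`-structure kept: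
  `Z(End⁰ A) ⊆ ℚ[1 ⊗ φ′]` and `u^* ∈ C(A) ⊗ ℂ` ⟹ `b · u^* = S(φ′^*)` for some `b ∈ ℤ ∖ {0}`, `S ∈ ℤ[T]`;
  `exists_root_of_hasEigenvalue_of_smul_eq_aeval` — then every eigenvalue `μ` of `u^*` is `S(ρ′)/b` for a complex root `ρ′`
  of `P′` (a common eigenvector of `φ′^*` inside the `μ`-eigenspace of `u^*`, which `φ′^*` preserves).
* §2 **`hasNoTypeIVFactor_of_center_le_adjoin_endAlgebra_of_forall_root_im_eq_zero`** — `Z(End⁰ A) ⊆ ℚ(φ′)` with `ℚ(φ′)`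
  totally real ⟹ `HasNoTypeIVFactor A` (`μ = S(ρ′)/b ∈ ℝ`; the seat's `hasNoTypeIVFactor_of_forall_hasEigenvalue_im_eq_zero`);
  `hasSemisimpleHodgeGroup_of_center_le_adjoin_endAlgebra_of_forall_root_im_eq_zero` — hence `Hdg` is semi-simple in the
  tree's sense (the tree's discharged `MoonenZarhin1999_semisimple_of_hasNoTypeIVFactor_holds`), with NO hypothesis on
  `W_{F′}`; `eigenMultiplicity_eq_of_center_le_adjoin_endAlgebra_of_forall_root_im_eq_zero`,
  `weilClassesField_le_hodgeClassSpan_of_center_le_adjoin_endAlgebra_of_forall_root_im_eq_zero` — and every `W_F` is Hodge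
  (the second Remark, the seat's `eigenMultiplicity_eq_of_hasNoTypeIVFactor`).

Honesty clause: a junction of the tree's predicate with the seat's dictionary; no classification of endomorphism algebras is
used; the converse («no type IV ⟹ the centre lies in a totally real FIELD») is false for non-isotypic `A` (the centre is a
product of fields) and is not claimed.
No `sorry`; axioms `propext`, `Classical.choice`, `Quot.sound`.

## References
* [MoonenZarhin1998WeilClasses] B. J. J. Moonen, Yu. G. Zarhin, *Weil classes on abelian varieties*, J. reine angew.
  Math. 496 (1998) 83–92 = arXiv:alg-geom/9612017, §1 second Remark after the Criterion (chunk p0002) and Remark (1) after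
  Criterion (2) (chunk p0004).
* [LangeBirkenhake1992] H. Lange, Ch. Birkenhake, *Complex Abelian Varieties*, §1.2 Prop. 1.2.3, §5.5 (Prop. 5.5.7).
* [MumfordAV1970] D. Mumford, *Abelian Varieties*, §19 Thm. 3.
* [MoonenZarhin1999LowDim] B. Moonen, Yu. Zarhin, Math. Ann. 315 (1999), §1.
-/

noncomputable section

open CategoryTheory Polynomial Module

namespace Literature.AlgebraicGeometry.HodgeTheory

open Literature.AlgebraicTopology.SingularHomology
open Literature.AlgebraicGeometry.Motives
open Literature.AlgebraicGeometry.VanGeemen1994 (pullbackOne hodgeClassSpan)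
open Literature.AlgebraicGeometry.Milne1999 (centralizerAlgebra mem_centralizerAlgebra_iff)

section HodgeTheory

variable {A : AbelianVariety ℂ} {φ' : A ⟶ A} {P' : Polynomial ℤ}

/-! ### §1 The dictionary with its `ℚ`-structure: `b · u^* = S(φ′^*)`, and the eigenvalues of `u^*` -/

section Dictionary

/-- **«`F′ ⊇ E`» IN `End⁰(A)` ⟹ `b · u^* = S(φ′^*)` WITH `b ∈ ℤ ∖ {0}`, `S ∈ ℤ[T]`** for every `u ∈ End(A)` with
`u^* ∈ C(A) ⊗ ℂ` (the seat's `pullbackOne_mem_adjoin_of_center_le_adjoin` with the rational structure kept: `1 ⊗ u =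
s(1 ⊗ φ′)`, `s ∈ ℚ[T]`; clear denominators; `End(A) ↪ End⁰(A)`; the rational representation).
[cite: MoonenZarhin1998WeilClasses, §1 Remark (1) after Criterion (2) («if F′ ⊇ E»)] [cite: MumfordAV1970, §19 Thm. 3]
[cite: LangeBirkenhake1992, §1.2 Prop. 1.2.3] -/
theorem exists_smul_pullbackOne_eq_aeval_of_center_le_adjoin
    (hZ : Subalgebra.center ℚ A.endAlgebra ≤ Algebra.adjoin ℚ {AbelianVariety.endAlgebra.of A φ'}) {u : A ⟶ A}
    (huC : pullbackOne A u ∈ centralizerAlgebra A) :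
    ∃ (b : ℤ) (S : Polynomial ℤ), b ≠ 0 ∧
      (b : ℂ) • pullbackOne A u = aeval (pullbackOne A φ') (S.map (Int.castRingHom ℂ)) := by
  -- `1 ⊗ u = s(1 ⊗ φ′)`, `s ∈ ℚ[T]`
  have hmem := hZ (endAlgebra_of_mem_center_of_pullbackOne_mem_centralizerAlgebra huC)
  rw [Algebra.adjoin_singleton_eq_range_aeval] at hmem
  obtain ⟨s, hs⟩ := hmem
  replace hs : aeval (AbelianVariety.endAlgebra.of A φ') s = AbelianVariety.endAlgebra.of A u := hs
  -- clear denominators: `S = b s ∈ ℤ[T]`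
  set S : Polynomial ℤ := IsLocalization.integerNormalization (nonZeroDivisors ℤ) s with hS
  obtain ⟨b, hbM, hb⟩ := IsLocalization.integerNormalization_spec (nonZeroDivisors ℤ) s
  rw [← hS, ← algebraMap_smul ℚ b s, Polynomial.smul_eq_C_mul] at hb
  have hb0 : b ≠ 0 := nonZeroDivisors.ne_zero hbM
  -- `S(1 ⊗ φ′) = b · (1 ⊗ u)` in `End⁰(A)`
  have hSφ : Polynomial.eval₂ ((algebraMap ℚ A.endAlgebra).comp (algebraMap ℤ ℚ))
      (AbelianVariety.endAlgebra.of A φ') S = (b : A.endAlgebra) * AbelianVariety.endAlgebra.of A u := by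
    rw [← Polynomial.eval₂_map, hb, ← Polynomial.aeval_def, map_mul, Polynomial.aeval_C, hs, eq_intCast, map_intCast]
  -- hence `S(φ′) = b • u` in `End(A)`
  have hSφ' : ((b • u : A ⟶ A) : CategoryTheory.End A) =
      Polynomial.eval₂ (Int.castRingHom (CategoryTheory.End A)) (φ' : CategoryTheory.End A) S := by
    apply AbelianVariety.endAlgebra.of_injective_of_charZero (A := A)
    rw [Polynomial.hom_eval₂,
      RingHom.ext_int ((AbelianVariety.endAlgebra.of A).comp (Int.castRingHom (CategoryTheory.End A)))
        ((algebraMap ℚ A.endAlgebra).comp (algebraMap ℤ ℚ)), hSφ,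
      show (b • u : A ⟶ A) = ((b • End.of u : CategoryTheory.End A)) from rfl, map_zsmul, zsmul_eq_mul]
  -- and `b • u^* = S(φ′^*)` on `H¹`
  refine ⟨b, S, hb0, ?_⟩
  have h := hom_complexBetti_map_one_of_eq_eval₂ hSφ'
  rw [complexBetti_map_zsmul_one, ModuleCat.hom_zsmul] at h
  rw [← h, Int.cast_smul_eq_zsmul]

/-- **The eigenvalues of such a `u^*` are the numbers `S(ρ′)/b` at complex roots `ρ′` of `P′`**: if `b · u^* = S(φ′^*)` with
`u^* ∈ C(A) ⊗ ℂ` (so `φ′^*` preserves each eigenspace of `u^*`) and `P′(φ′) = 0`, then for every eigenvalue `μ` of `u^*`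
there is a complex root `ρ′` of `P′` with `b μ = S(ρ′)` (a `φ′^*`-eigenvector inside the `μ`-eigenspace of `u^*`).
[cite: LangeBirkenhake1992, §1.2 Prop. 1.2.3] -/
theorem exists_root_of_hasEigenvalue_of_smul_eq_aeval
    (hφ' : Polynomial.eval₂ (Int.castRingHom (CategoryTheory.End A)) (φ' : CategoryTheory.End A) P' = 0) {u : A ⟶ A}
    (huC : pullbackOne A u ∈ centralizerAlgebra A) {b : ℤ} {S : Polynomial ℤ}
    (hbS : (b : ℂ) • pullbackOne A u = aeval (pullbackOne A φ') (S.map (Int.castRingHom ℂ))) {μ : ℂ}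
    (hμ : (pullbackOne A u).HasEigenvalue μ) :
    ∃ ρ' : ℂ, Polynomial.eval₂ (Int.castRingHom ℂ) ρ' P' = 0 ∧ (b : ℂ) * μ = (S.map (Int.castRingHom ℂ)).eval ρ' := by
  haveI := finite_complexBetti_abelianVariety A 1
  set T : Module.End ℂ (complexBetti A.X 1) := pullbackOne A u with hT
  set F : Module.End ℂ (complexBetti A.X 1) := pullbackOne A φ' with hF
  -- `φ′^*` preserves the `μ`-eigenspace `W` of `u^*`
  have hcomm : F * T = T * F := (mem_centralizerAlgebra_iff.1 huC) φ'
  have hW : ∀ x ∈ T.eigenspace μ, F x ∈ T.eigenspace μ := by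
    intro x hx
    rw [Module.End.mem_eigenspace_iff] at hx ⊢
    have h := LinearMap.congr_fun hcomm x
    rw [Module.End.mul_apply, Module.End.mul_apply, hx, map_smul] at h
    exact h.symm
  -- a `φ′^*`-eigenvector `w ∈ W`
  haveI : Nontrivial ↥(T.eigenspace μ) := (Submodule.nontrivial_iff_ne_bot).2 hμ
  obtain ⟨ρ', hρ'⟩ := Module.End.exists_eigenvalue (F.restrict hW)
  obtain ⟨w, hw⟩ := hρ'.exists_hasEigenvector
  have hw0 : (w : complexBetti A.X 1) ≠ 0 := fun h => hw.2 (Subtype.ext h)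
  have hFw : F w = ρ' • (w : complexBetti A.X 1) := by
    have h := congrArg Subtype.val hw.apply_eq_smul
    rwa [LinearMap.restrict_apply] at h
  have hTw : T w = μ • (w : complexBetti A.X 1) := Module.End.mem_eigenspace_iff.1 w.2
  have hvec : F.HasEigenvector ρ' (w : complexBetti A.X 1) := ⟨Module.End.mem_eigenspace_iff.2 hFw, hw0⟩
  -- `ρ′` is a root of `P′`
  have hF0 : aeval F (P'.map (Int.castRingHom ℂ)) = 0 := aeval_hom_complexBetti_map_one_eq_zero hφ'
  have hroot : Polynomial.eval₂ (Int.castRingHom ℂ) ρ' P' = 0 := by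
    have h := Module.End.aeval_apply_of_hasEigenvector (p := P'.map (Int.castRingHom ℂ)) hvec
    rw [hF0, LinearMap.zero_apply, Polynomial.eval_map] at h
    exact (smul_eq_zero.1 h.symm).resolve_right hw0
  -- `b μ w = S(φ′^*) w = S(ρ′) w`
  refine ⟨ρ', hroot, smul_left_injective ℂ hw0 ?_⟩
  have h := LinearMap.congr_fun hbS (w : complexBetti A.X 1)
  rw [LinearMap.smul_apply, hTw, smul_smul, Module.End.aeval_apply_of_hasEigenvector hvec] at h
  exact h

end Dictionary

/-! ### §2 `Z(End⁰ A) ⊆ ℚ(φ′)` totally real ⟹ no factor of type IV -/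

section TotallyReal

/-- **`Z(End⁰ A)` INSIDE A TOTALLY REAL SUBFIELD `ℚ(φ′) ⊆ End⁰(A)` ⟹ NO FACTOR OF TYPE IV** (`P′ ∈ ℤ[T]` irreducible over `ℚ`
with only real complex roots, `P′(φ′) = 0`, `Subalgebra.center ℚ A.endAlgebra ≤ ℚ[1 ⊗ φ′]`): a central pull-back `u^*` has
`b · u^* = S(φ′^*)`, so its eigenvalues `S(ρ′)/b` are real, and the seat's carrier characterization
`hasNoTypeIVFactor_of_forall_hasEigenvalue_im_eq_zero` applies. [cite: MoonenZarhin1998WeilClasses, §1 second Remark after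
the Criterion (chunk p0002) and Remark (1) after Criterion (2) (chunk p0004)] [cite: LangeBirkenhake1992, §5.5 (the centre of
End⁰ is totally real for types I–III)] -/
theorem hasNoTypeIVFactor_of_center_le_adjoin_endAlgebra_of_forall_root_im_eq_zero
    (hZ : Subalgebra.center ℚ A.endAlgebra ≤ Algebra.adjoin ℚ {AbelianVariety.endAlgebra.of A φ'})
    (hφ' : Polynomial.eval₂ (Int.castRingHom (CategoryTheory.End A)) (φ' : CategoryTheory.End A) P' = 0)
    (hreal : ∀ ρ' : ℂ, Polynomial.eval₂ (Int.castRingHom ℂ) ρ' P' = 0 → ρ'.im = 0) : HasNoTypeIVFactor A := by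
  refine hasNoTypeIVFactor_of_forall_hasEigenvalue_im_eq_zero fun u huC μ hμ => ?_
  obtain ⟨b, S, hb0, hbS⟩ := exists_smul_pullbackOne_eq_aeval_of_center_le_adjoin hZ huC
  obtain ⟨ρ', hρ', hμ'⟩ := exists_root_of_hasEigenvalue_of_smul_eq_aeval hφ' huC hbS hμ
  -- `S(ρ′)` is real for `ρ′` real
  have hre : ρ' = ((ρ'.re : ℝ) : ℂ) := by
    apply Complex.ext
    · rw [Complex.ofReal_re]
    · rw [Complex.ofReal_im, hreal ρ' hρ']
  have him : ((S.map (Int.castRingHom ℂ)).eval ρ').im = 0 := by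
    rw [hre, Polynomial.eval_map, ← Complex.ofRealHom_eq_coe,
      show Int.castRingHom ℂ = Complex.ofRealHom.comp (Int.castRingHom ℝ) from RingHom.ext_int _ _,
      ← Polynomial.hom_eval₂, Complex.ofRealHom_eq_coe, Complex.ofReal_im]
  have h := congrArg Complex.im hμ'
  rw [him, Complex.mul_im, Complex.intCast_re, Complex.intCast_im, zero_mul, add_zero] at h
  exact (mul_eq_zero.1 h).resolve_left (Int.cast_ne_zero.2 hb0)

/-- **… hence `Hdg(A)` is semi-simple in the tree's sense (finite centre), with NO hypothesis on `W_{F′}`** (the tree's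
discharged `MoonenZarhin1999_semisimple_of_hasNoTypeIVFactor_holds`; compare the seat's
`hasSemisimpleHodgeGroup_of_center_le_adjoin_endAlgebra`, which needs `W_{F′}` Hodge but no reality).
[cite: MoonenZarhin1998WeilClasses, §1 Remark (1) after Criterion (2) (chunk p0004) and second Remark (chunk p0002)]
[cite: MoonenZarhin1999LowDim, §1] -/
theorem hasSemisimpleHodgeGroup_of_center_le_adjoin_endAlgebra_of_forall_root_im_eq_zero
    (hZ : Subalgebra.center ℚ A.endAlgebra ≤ Algebra.adjoin ℚ {AbelianVariety.endAlgebra.of A φ'})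
    (hφ' : Polynomial.eval₂ (Int.castRingHom (CategoryTheory.End A)) (φ' : CategoryTheory.End A) P' = 0)
    (hreal : ∀ ρ' : ℂ, Polynomial.eval₂ (Int.castRingHom ℂ) ρ' P' = 0 → ρ'.im = 0) : HasSemisimpleHodgeGroup A :=
  MoonenZarhin1999_semisimple_of_hasNoTypeIVFactor_holds A
    (hasNoTypeIVFactor_of_center_le_adjoin_endAlgebra_of_forall_root_im_eq_zero hZ hφ' hreal)

variable {φ : A ⟶ A} {P : Polynomial ℤ} {e m : ℕ}

/-- **… and every `F = ℚ(φ) ⊆ End⁰(A)` has balanced multiplicities `n_ρ = n_ρ̄`** (the second Remark, the seat's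
`eigenMultiplicity_eq_of_hasNoTypeIVFactor`). [cite: MoonenZarhin1998WeilClasses, §1 second Remark after the Criterion (chunk p0002)] -/
theorem eigenMultiplicity_eq_of_center_le_adjoin_endAlgebra_of_forall_root_im_eq_zero
    (hZ : Subalgebra.center ℚ A.endAlgebra ≤ Algebra.adjoin ℚ {AbelianVariety.endAlgebra.of A φ'})
    (hφ' : Polynomial.eval₂ (Int.castRingHom (CategoryTheory.End A)) (φ' : CategoryTheory.End A) P' = 0)
    (hreal : ∀ ρ' : ℂ, Polynomial.eval₂ (Int.castRingHom ℂ) ρ' P' = 0 → ρ'.im = 0)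
    (hPirr : Irreducible (P.map (Int.castRingHom ℚ)))
    (hφ : Polynomial.eval₂ (Int.castRingHom (CategoryTheory.End A)) (φ : CategoryTheory.End A) P = 0) (ρ : ℂ) :
    eigenMultiplicity A φ ρ = eigenMultiplicity A φ (starRingEnd ℂ ρ) :=
  eigenMultiplicity_eq_of_hasNoTypeIVFactor
    (hasNoTypeIVFactor_of_center_le_adjoin_endAlgebra_of_forall_root_im_eq_zero hZ hφ' hreal) hPirr hφ ρ

/-- **… so every `W_F ⊗ ℂ ≤ Bᵐ ⊗ ℂ`** (`P` monic irreducible of degree `e`, `P(φ) = 0`, `e · 2m = 2 dim A`).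
[cite: MoonenZarhin1998WeilClasses, §1 second Remark after the Criterion (chunk p0002) and the Criterion (chunk p0001)] -/
theorem weilClassesField_le_hodgeClassSpan_of_center_le_adjoin_endAlgebra_of_forall_root_im_eq_zero
    (hZ : Subalgebra.center ℚ A.endAlgebra ≤ Algebra.adjoin ℚ {AbelianVariety.endAlgebra.of A φ'})
    (hφ' : Polynomial.eval₂ (Int.castRingHom (CategoryTheory.End A)) (φ' : CategoryTheory.End A) P' = 0)
    (hreal : ∀ ρ' : ℂ, Polynomial.eval₂ (Int.castRingHom ℂ) ρ' P' = 0 → ρ'.im = 0)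
    (hPm : P.Monic) (hPe : P.natDegree = e) (hPirr : Irreducible (P.map (Int.castRingHom ℚ)))
    (hφ : Polynomial.eval₂ (Int.castRingHom (CategoryTheory.End A)) (φ : CategoryTheory.End A) P = 0)
    (her : e * (2 * m) = 2 * A.dim) :
    weilClassesField A φ P (2 * m) ≤ hodgeClassSpan A.dim A.X m :=
  weilClassesField_le_hodgeClassSpan_of_hasNoTypeIVFactor
    (hasNoTypeIVFactor_of_center_le_adjoin_endAlgebra_of_forall_root_im_eq_zero hZ hφ' hreal) hPm hPe hPirr hφ her

end TotallyReal

end HodgeTheory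

end Literature.AlgebraicGeometry.HodgeTheory

end
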